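import Summits.Ventures.HSemireg.WedgeHankelOuterPieces
import Summits.Ventures.HSemireg.WedgeHankelCoSiegelTower

/-!
# Venture HSemireg — THE PAIR-TYPE PIECES OF THE SIEGEL IDEAL AND THE EXCESS LAW PIECE BY PIECE: `SI_k` is pair-graded, its full-pair pieces are everything, its PURE piece on a
# `k`-set `A` of pairs has dimension `2^k − (k+1)` (a complement of the `k+1` standard monomials `x_{A∖A_i} ∧ y_{A_i}`), and therefore **every `k`-set `A` carries the excess
# `dim (Kr(univ, w_N q, k) ⊓ Sp(ptype = 𝟙_A)) − dim (SI_k ⊓ Sp(ptype = 𝟙_A)) = k + 1 − rank H_k(q)` EXACTLY**, the full-pair pieces none — th-7/p10's global excess law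
# `dim Kr − dim SI_k = C(n,k)·(k+1 − r_k(q))` distributed evenly over the `C(n,k)` sets `A`

HONEST FRAMING. Part of the Lean index of the computation cell `pub-hsemireg` (seat p10 gen 23, Sunday typer «UNIFORM-IN-n»).
Finite-dimensional EXTERIOR ALGEBRA over a field ONLY: no variety, no cohomology theory, no sheaf, no Ext group, no semiregularity map;
nothing here says that HC / HC_CM / HC_AV holds; no Literature fact is declared or used.  Custodian versions as in `WedgeHankelSiegelIdeal` (1/3); the dictionary (`SI_k` = th-6's
«Θ-isotropic part»; pair type = multidegree) is QUOTED, never asserted.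

WHAT IS IN THE TREE.  Gen 11 `siegelIdeal`, `sym`, `sym_eq_zero_of_mem_siegelIdeal`, the standard monomials `rep` (`x_{S∖canon S i} ∧ y_{canon S i}`), `repSpan`, `linearIndependent_sym_rep`,
`B_mem_siegelIdeal_of_pair`, `B_mem_repSpan_sup` (every monomial is standard modulo `SI`); G6 `KernelDuality.siegelIdeal_eq_iInf_Kr_w` (`SI_k = ⋂_q Kr(univ, w_n q, k)`, `k ≤ n`);
H10 `proj_ptype_mem_Kr_w`; L2 (this seat) `finrank_Sp_pure`, `card_eq_of_ptype_eq_indicator`, `ptype_image_xJ/yJ`, `disjoint_image_xJ_image_yJ`, `finrank_Kr_w_inf_Sp_pure_add`; L4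
`pair_subset_of_two_le_ptype`, `Kr_inf_Sp_ptype_eq_Hom_inf_of_two_le`.
THIS FILE (namespace `Summit.Ventures.HSemireg.Wedge.HankelOuter` continued; imports L4 and G6):
* §388 `siegelIdeal_le_Hom_univ`, **`proj_ptype_mem_siegelIdeal`** (`SI_k` is pair-graded, `k ≤ N`), **`Hom_inf_Sp_ptype_le_siegelIdeal_of_two_le`** /
  **`siegelIdeal_inf_Sp_ptype_eq_Hom_inf_of_two_le`** (a full-pair piece is all Siegel), **`Kr_w_inf_Sp_ptype_eq_siegelIdeal_inf_of_two_le`** (NO EXCESS on full-pair types).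
* §389 THE PURE PIECE OF `SI`: `xs_eq_image` / `ys_eq_image`, `ptype_supp_rep` (the standard monomial `r_{S,i}` is pure on `S`), `pairIndicator_injective`, `proj_pure_rep`,
  `proj_pure_mem_span_rep` (the `𝟙_A`-projection of `repSpan` is the span of the `|A|+1` monomials `r_{A,i}`), `Sp_pure_le_span_rep_sup`, `linearIndependent_rep_pure`,
  `span_rep_pure_inf_siegelIdeal_eq_bot`, and **`finrank_siegelIdeal_inf_Sp_pure_add`: `dim (SI_{|A|} ⊓ Sp(ptype = 𝟙_A)) + (|A| + 1) = 2^{|A|}`** for EVERY set `A` of pairs.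
* §390 **THE EXCESS LAW PIECE BY PIECE: `finrank_Kr_w_inf_Sp_pure_eq_siegelIdeal_add`:
  `dim (Kr(univ, w_N q, |A|) ⊓ Sp(ptype = 𝟙_A)) + rank (hankel1 K N |A| q) = dim (SI_{|A|} ⊓ Sp(ptype = 𝟙_A)) + (|A| + 1)`** — every `A`, `q`, field; and
  **`Kr_w_inf_Sp_pure_eq_siegelIdeal_inf_iff`**: the two pure pieces coincide iff `rank H_{|A|}(q) = |A| + 1` (gen 11's «kernel = Siegel ideal at the generic rank», piece by piece).
READING: the pure piece of the kernel exceeds the pure piece of the Siegel ideal by exactly `k + 1 − r_k(q)` for each of the `C(n,k)` sets `A`; summing over `A` (and adding the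
full-pair pieces, where kernel = Siegel ideal) recovers gen 11's EXCESS LAW.  Nothing Ext-side.  New names only.
-/

open Module

namespace Summit.Ventures.HSemireg.Wedge.HankelOuter

open Summit.Ventures.HSemireg.Wedge Summit.Ventures.HSemireg.Wedge.Kunneth Summit.Ventures.HSemireg.Wedge.Hankel
  Summit.Ventures.HSemireg.Wedge.BasisFree Summit.Ventures.HSemireg.Wedge.HankelSiegel Summit.Ventures.HSemireg.Wedge.HankelSiegelIdeal
  Summit.Ventures.HSemireg.Wedge.KunnethKernel Summit.Ventures.HSemireg.Wedge.HankelFrameChange Summit.Ventures.HSemireg.Wedge.Weil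
  Summit.Ventures.HSemireg.Wedge.HankelPairMixing Summit.Ventures.HSemireg.Wedge.HankelPairGrading

variable (K : Type*) [Field K] {N : ℕ}

/-! ## §388. The Siegel ideal is pair-graded; its full-pair pieces are everything -/

/-- `SI_k ≤ Hom(univ, k)`. -/
theorem siegelIdeal_le_Hom_univ (k : ℕ) : siegelIdeal K N k ≤ Hom K (In N) (Finset.univ : Finset (In N)) k := by
  rw [← exteriorPower_eq_Hom_univ]
  exact siegelIdeal_le_exteriorPower K k

/-- **THE SIEGEL IDEAL IS PAIR-GRADED: `θ ∈ SI_k ⇒ proj_{ptype = τ} θ ∈ SI_k`** (`k ≤ N`; `SI_k` is the intersection of the pair-graded kernels `Kr(univ, w_N q, k)`, G6 + H10). -/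
theorem proj_ptype_mem_siegelIdeal {k : ℕ} (hk : k ≤ N) (τ : Fin N → ℕ) {θ : HT K (In N)} (hθ : θ ∈ siegelIdeal K N k) :
    proj (K := K) (fun s : Finset (In N) => ptype s = τ) θ ∈ siegelIdeal K N k := by
  classical
  rw [KernelDuality.siegelIdeal_eq_iInf_Kr_w K hk, Submodule.mem_iInf] at hθ ⊢
  exact fun q => proj_ptype_mem_Kr_w K τ q (hθ q)

/-- **a pair-type piece with a FULL PAIR is all Siegel: `Hom(univ, k) ⊓ Sp(ptype = τ) ≤ SI_k` when `τ c ≥ 2`** (each monomial contains `x_c ∧ y_c`). -/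
theorem Hom_inf_Sp_ptype_le_siegelIdeal_of_two_le {τ : Fin N → ℕ} {c : Fin N} (h : 2 ≤ τ c) (k : ℕ) :
    Hom K (In N) (Finset.univ : Finset (In N)) k ⊓ Sp K (fun s : Finset (In N) => ptype s = τ) ≤ siegelIdeal K N k := by
  rw [Hom_eq_Sp, Sp_inf_Sp, Sp, Submodule.span_le]
  rintro _ ⟨s, ⟨⟨-, hsk⟩, hs⟩, rfl⟩
  have h2 : 2 ≤ ptype s c := by rw [show ptype s = τ from hs]; exact h
  obtain ⟨hx, hy⟩ := pair_subset_of_two_le_ptype h2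
  rw [SetLike.mem_coe, ← hsk]
  exact B_mem_siegelIdeal_of_pair K hx hy

/-- **`SI_k ⊓ Sp(ptype = τ) = Hom(univ, k) ⊓ Sp(ptype = τ)` when `τ c ≥ 2`.** -/
theorem siegelIdeal_inf_Sp_ptype_eq_Hom_inf_of_two_le {τ : Fin N → ℕ} {c : Fin N} (h : 2 ≤ τ c) (k : ℕ) :
    siegelIdeal K N k ⊓ Sp K (fun s : Finset (In N) => ptype s = τ) = Hom K (In N) (Finset.univ : Finset (In N)) k ⊓ Sp K (fun s : Finset (In N) => ptype s = τ) :=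
  le_antisymm (inf_le_inf (siegelIdeal_le_Hom_univ K k) le_rfl) (le_inf (Hom_inf_Sp_ptype_le_siegelIdeal_of_two_le K h k) inf_le_right)

/-- **NO EXCESS ON FULL-PAIR TYPES: `Kr(univ, w_N q, k) ⊓ Sp(ptype = τ) = SI_k ⊓ Sp(ptype = τ)` when `τ c ≥ 2`** (both are the whole piece). -/
theorem Kr_w_inf_Sp_ptype_eq_siegelIdeal_inf_of_two_le {τ : Fin N → ℕ} {c : Fin N} (h : 2 ≤ τ c) (q : ℕ → K) (k : ℕ) :
    Kr K (Finset.univ : Finset (In N)) (w K N N q) k ⊓ Sp K (fun s : Finset (In N) => ptype s = τ) = siegelIdeal K N k ⊓ Sp K (fun s : Finset (In N) => ptype s = τ) := by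
  rw [Kr_inf_Sp_ptype_eq_Hom_inf_of_two_le K h (w_mem_Sp_Tr K q), siegelIdeal_inf_Sp_ptype_eq_Hom_inf_of_two_le K h]

/-! ## §389. The pure piece of the Siegel ideal -/

omit [Field K] in
/-- gen 11's `xs P` is the set of `x`-letters of `P`. -/
theorem xs_eq_image (P : Finset (Fin N)) : xs P = P.image (xJ N) := by
  ext i
  simp only [xs, Finset.mem_map, Finset.mem_image]
  rfl

omit [Field K] in
/-- gen 11's `ys Q` is the set of `y`-letters of `Q`. -/
theorem ys_eq_image (Q : Finset (Fin N)) : ys Q = Q.image (yJ N) := by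
  ext i
  simp only [ys, Finset.mem_map, Finset.mem_image]
  rfl

omit [Field K] in
/-- `x`-letters on `S ∖ Q` and `y`-letters on `Q ⊆ S` make a pure support on `S`. -/
theorem ptype_xs_union_ys {S Q : Finset (Fin N)} (hQ : Q ⊆ S) : ptype (xs (S \ Q) ∪ ys Q) = fun c => if c ∈ S then 1 else 0 := by
  rw [xs_eq_image, ys_eq_image, ptype_union (disjoint_image_xJ_image_yJ _ _), ptype_image_xJ, ptype_image_yJ]
  funext c
  simp only [Pi.add_apply, Finset.mem_sdiff]
  by_cases hcQ : c ∈ Q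
  · rw [if_neg (fun h => h.2 hcQ), if_pos hcQ, if_pos (hQ hcQ)]
  · by_cases hcS : c ∈ S
    · rw [if_pos ⟨hcS, hcQ⟩, if_neg hcQ, if_pos hcS]
    · rw [if_neg (fun h => hcS h.1), if_neg hcQ, if_neg hcS]

omit [Field K] in
/-- **the standard monomial `r_{S,i}` is pure on `S`**: its support has pair type `𝟙_S`. -/
theorem ptype_supp_rep {k : ℕ} (p : RIdx N k) : ptype (xs (p.1.1 \ canon p.1.1 p.2) ∪ ys (canon p.1.1 p.2)) = fun c => if c ∈ p.1.1 then 1 else 0 :=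
  ptype_xs_union_ys (canon_subset _ _)

/-- `r_{S,i} ∈ Sp(ptype = 𝟙_S)`. -/
theorem rep_mem_Sp_pure {k : ℕ} (p : RIdx N k) : rep K p ∈ Sp K (fun s : Finset (In N) => ptype s = fun c => if c ∈ p.1.1 then 1 else 0) := by
  obtain ⟨c, -, hc⟩ := rep_eq_smul_B K p
  rw [hc]
  exact Submodule.smul_mem _ _ (B_mem_Sp (ptype_supp_rep p))

omit [Field K] in
/-- indicators of finite sets are injective. -/
theorem pairIndicator_injective {S A : Finset (Fin N)} (h : (fun c : Fin N => if c ∈ S then (1 : ℕ) else 0) = fun c => if c ∈ A then 1 else 0) : S = A := by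
  ext c
  have hc : (if c ∈ S then (1 : ℕ) else 0) = if c ∈ A then 1 else 0 := congr_fun h c
  by_cases hS : c ∈ S <;> by_cases hA : c ∈ A
  · exact ⟨fun _ => hA, fun _ => hS⟩
  · rw [if_pos hS, if_neg hA] at hc
    exact absurd hc one_ne_zero
  · rw [if_neg hS, if_pos hA] at hc
    exact absurd hc.symm one_ne_zero
  · exact ⟨fun h' => absurd h' hS, fun h' => absurd h' hA⟩

/-- the `𝟙_A`-projection of a standard monomial: itself if `S = A`, else `0`. -/
theorem proj_pure_rep (A : Finset (Fin N)) {k : ℕ} (p : RIdx N k) [DecidablePred fun s : Finset (In N) => ptype s = fun c => if c ∈ A then 1 else 0] :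
    proj (K := K) (fun s : Finset (In N) => ptype s = fun c => if c ∈ A then 1 else 0) (rep K p) = if p.1.1 = A then rep K p else 0 := by
  obtain ⟨c, -, hc⟩ := rep_eq_smul_B K p
  rw [hc, map_smul, proj_B]
  have hsupp := ptype_supp_rep (N := N) p
  by_cases hSA : p.1.1 = A
  · rw [if_pos (show ptype (xs (p.1.1 \ canon p.1.1 p.2) ∪ ys (canon p.1.1 p.2)) = (fun c => if c ∈ A then 1 else 0) by rw [hsupp, hSA]), if_pos hSA]
  · rw [if_neg (show ¬ ptype (xs (p.1.1 \ canon p.1.1 p.2) ∪ ys (canon p.1.1 p.2)) = (fun c => if c ∈ A then 1 else 0) from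
        fun h => hSA (pairIndicator_injective (hsupp.symm.trans h))), if_neg hSA, smul_zero]

/-- **the `𝟙_A`-projection of `repSpan` is the span of the `|A|+1` standard monomials `r_{A,i}`.** -/
theorem proj_pure_mem_span_rep (A : Finset (Fin N)) [DecidablePred fun s : Finset (In N) => ptype s = fun c => if c ∈ A then 1 else 0]
    {r : HT K (In N)} (hr : r ∈ repSpan K N A.card) :
    proj (K := K) (fun s : Finset (In N) => ptype s = fun c => if c ∈ A then 1 else 0) r
      ∈ Submodule.span K (Set.range fun i : Fin (A.card + 1) => rep K ((⟨⟨A, rfl⟩, i⟩ : RIdx N A.card))) := by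
  induction hr using Submodule.span_induction with
  | mem x hx =>
    obtain ⟨p, rfl⟩ := hx
    rw [proj_pure_rep]
    split_ifs with hpA
    · obtain ⟨⟨S, hS⟩, i⟩ := p
      simp only at hpA
      subst hpA
      exact Submodule.subset_span ⟨i, rfl⟩
    · exact Submodule.zero_mem _
  | zero => rw [map_zero]; exact Submodule.zero_mem _
  | add x y _ _ hx hy => rw [map_add]; exact Submodule.add_mem _ hx hy
  | smul a x _ hx => rw [map_smul]; exact Submodule.smul_mem _ _ hx

/-- **`Sp(ptype = 𝟙_A) ≤ span{r_{A,i}} ⊔ (SI_{|A|} ⊓ Sp(ptype = 𝟙_A))`**: every pure monomial is standard modulo the Siegel ideal (gen 11), projected onto the `𝟙_A`-piece. -/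
theorem Sp_pure_le_span_rep_sup (A : Finset (Fin N)) :
    Sp K (fun s : Finset (In N) => ptype s = fun c => if c ∈ A then 1 else 0)
      ≤ Submodule.span K (Set.range fun i : Fin (A.card + 1) => rep K ((⟨⟨A, rfl⟩, i⟩ : RIdx N A.card)))
        ⊔ siegelIdeal K N A.card ⊓ Sp K (fun s : Finset (In N) => ptype s = fun c => if c ∈ A then 1 else 0) := by
  classical
  have hA : A.card ≤ N := by have h := Finset.card_le_univ A; rwa [Fintype.card_fin] at h
  change Submodule.span K ((fun s : Finset (In N) => B K (In N) s) '' {s | ptype s = fun c => if c ∈ A then 1 else 0}) ≤ _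
  rw [Submodule.span_le]
  rintro _ ⟨t, ht, rfl⟩
  have ht' : ptype t = fun c => if c ∈ A then 1 else 0 := ht
  have htc : t.card = A.card := card_eq_of_ptype_eq_indicator ht'
  have hmem := B_mem_repSpan_sup K t
  rw [htc, Submodule.mem_sup] at hmem
  obtain ⟨r, hr, s, hs, hrs⟩ := hmem
  have hproj : proj (K := K) (fun s : Finset (In N) => ptype s = fun c => if c ∈ A then 1 else 0) (B K (In N) t) = B K (In N) t :=
    proj_eq_self (fun s h => h) (B_mem_Sp (P := fun s : Finset (In N) => ptype s = fun c => if c ∈ A then 1 else 0) ht')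
  show B K (In N) t ∈ _
  rw [← hproj, ← hrs, map_add]
  exact Submodule.add_mem_sup (proj_pure_mem_span_rep K A hr) ⟨proj_ptype_mem_siegelIdeal K hA _ hs, proj_mem _ s⟩

/-- the standard monomials `r_{A,i}` are pure on `A`. -/
theorem rep_pure_mem_Sp (A : Finset (Fin N)) (i : Fin (A.card + 1)) :
    rep K ((⟨⟨A, rfl⟩, i⟩ : RIdx N A.card)) ∈ Sp K (fun s : Finset (In N) => ptype s = fun c => if c ∈ A then 1 else 0) :=
  rep_mem_Sp_pure K ((⟨⟨A, rfl⟩, i⟩ : RIdx N A.card))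

/-- the span of the `r_{A,i}` lies in the pure piece. -/
theorem span_rep_pure_le_Sp (A : Finset (Fin N)) :
    Submodule.span K (Set.range fun i : Fin (A.card + 1) => rep K ((⟨⟨A, rfl⟩, i⟩ : RIdx N A.card)))
      ≤ Sp K (fun s : Finset (In N) => ptype s = fun c => if c ∈ A then 1 else 0) := by
  rw [Submodule.span_le]
  rintro _ ⟨i, rfl⟩
  exact rep_pure_mem_Sp K A i

/-- the `|A|+1` standard monomials `r_{A,i}` are linearly independent (their images under `sym` are). -/
theorem linearIndependent_rep_pure (A : Finset (Fin N)) : LinearIndependent K fun i : Fin (A.card + 1) => rep K ((⟨⟨A, rfl⟩, i⟩ : RIdx N A.card)) := by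
  have h := (linearIndependent_sym_rep K (n := N) A.card).comp (fun i : Fin (A.card + 1) => ((⟨⟨A, rfl⟩, i⟩ : RIdx N A.card)))
    (fun i j hij => by simpa using hij)
  exact LinearIndependent.of_comp (sym K).toLinearMap h

/-- **`span{r_{A,i}} ⊓ SI_{|A|} = ⊥`**: `sym` kills the Siegel ideal and is injective on the span of the standard monomials. -/
theorem span_rep_pure_inf_siegelIdeal_eq_bot (A : Finset (Fin N)) :
    Submodule.span K (Set.range fun i : Fin (A.card + 1) => rep K ((⟨⟨A, rfl⟩, i⟩ : RIdx N A.card))) ⊓ siegelIdeal K N A.card = ⊥ := by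
  rw [Submodule.eq_bot_iff]
  rintro v ⟨hv, hvS⟩
  obtain ⟨c, rfl⟩ := (Submodule.mem_span_range_iff_exists_fun K).mp hv
  have h0 := sym_eq_zero_of_mem_siegelIdeal K hvS
  rw [map_sum] at h0
  simp_rw [map_smul] at h0
  have hli := (linearIndependent_sym_rep K (n := N) A.card).comp (fun i : Fin (A.card + 1) => ((⟨⟨A, rfl⟩, i⟩ : RIdx N A.card)))
    (fun i j hij => by simpa using hij)
  have hc : ∀ i, c i = 0 := fun i => Fintype.linearIndependent_iff.mp hli c h0 i
  simp [hc]

/-- **THE PURE PIECE OF THE SIEGEL IDEAL: `dim (SI_{|A|} ⊓ Sp(ptype = 𝟙_A)) + (|A| + 1) = 2^{|A|}`** for every set `A` of pairs, every field (the `|A|+1` standard monomials span a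
complement of it inside the `2^{|A|}`-dimensional pure piece). -/
theorem finrank_siegelIdeal_inf_Sp_pure_add (A : Finset (Fin N)) :
    finrank K ↥(siegelIdeal K N A.card ⊓ Sp K (fun s : Finset (In N) => ptype s = fun c => if c ∈ A then 1 else 0)) + (A.card + 1) = 2 ^ A.card := by
  have hsup : Submodule.span K (Set.range fun i : Fin (A.card + 1) => rep K ((⟨⟨A, rfl⟩, i⟩ : RIdx N A.card)))
      ⊔ siegelIdeal K N A.card ⊓ Sp K (fun s : Finset (In N) => ptype s = fun c => if c ∈ A then 1 else 0)
      = Sp K (fun s : Finset (In N) => ptype s = fun c => if c ∈ A then 1 else 0) :=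
    le_antisymm (sup_le (span_rep_pure_le_Sp K A) inf_le_right) (Sp_pure_le_span_rep_sup K A)
  have hinf : Submodule.span K (Set.range fun i : Fin (A.card + 1) => rep K ((⟨⟨A, rfl⟩, i⟩ : RIdx N A.card)))
      ⊓ (siegelIdeal K N A.card ⊓ Sp K (fun s : Finset (In N) => ptype s = fun c => if c ∈ A then 1 else 0)) = ⊥ :=
    le_bot_iff.mp (le_trans (inf_le_inf le_rfl inf_le_left) (le_of_eq (span_rep_pure_inf_siegelIdeal_eq_bot K A)))
  have hRdim : finrank K ↥(Submodule.span K (Set.range fun i : Fin (A.card + 1) => rep K ((⟨⟨A, rfl⟩, i⟩ : RIdx N A.card)))) = A.card + 1 := by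
    rw [finrank_span_eq_card (linearIndependent_rep_pure K A), Fintype.card_fin]
  have h := Submodule.finrank_sup_add_finrank_inf_eq
    (Submodule.span K (Set.range (fun i : Fin (A.card + 1) => rep K ((⟨⟨A, rfl⟩, i⟩ : RIdx N A.card)))))
    (siegelIdeal K N A.card ⊓ Sp K (fun s : Finset (In N) => ptype s = fun c => if c ∈ A then 1 else 0))
  rw [hsup, hinf, finrank_bot, add_zero, finrank_Sp_pure, hRdim] at h
  omega

/-- subtraction form: **`dim (SI_{|A|} ⊓ Sp(ptype = 𝟙_A)) = 2^{|A|} − (|A| + 1)`.** -/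
theorem finrank_siegelIdeal_inf_Sp_pure_eq (A : Finset (Fin N)) :
    finrank K ↥(siegelIdeal K N A.card ⊓ Sp K (fun s : Finset (In N) => ptype s = fun c => if c ∈ A then 1 else 0)) = 2 ^ A.card - (A.card + 1) := by
  have h := finrank_siegelIdeal_inf_Sp_pure_add K A
  omega

/-! ## §390. The excess law piece by piece -/

/-- **THE EXCESS LAW PIECE BY PIECE: `dim (Kr(univ, w_N q, |A|) ⊓ Sp(ptype = 𝟙_A)) + rank (hankel1 K N |A| q) = dim (SI_{|A|} ⊓ Sp(ptype = 𝟙_A)) + (|A| + 1)`** — each set `A` of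
pairs carries the excess `|A| + 1 − r_{|A|}(q)` exactly (every field, every `q`, uniform in `n`); the full-pair pieces carry none (§388). -/
theorem finrank_Kr_w_inf_Sp_pure_eq_siegelIdeal_add (A : Finset (Fin N)) (q : ℕ → K) :
    finrank K ↥(Kr K (Finset.univ : Finset (In N)) (w K N N q) A.card ⊓ Sp K (fun s : Finset (In N) => ptype s = fun c => if c ∈ A then 1 else 0))
        + (hankel1 K N A.card q).rank
      = finrank K ↥(siegelIdeal K N A.card ⊓ Sp K (fun s : Finset (In N) => ptype s = fun c => if c ∈ A then 1 else 0)) + (A.card + 1) := by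
  rw [finrank_Kr_w_inf_Sp_pure_add, finrank_siegelIdeal_inf_Sp_pure_add]

/-- the pure piece of the Siegel ideal sits inside the pure piece of every kernel. -/
theorem siegelIdeal_inf_Sp_pure_le_Kr (A : Finset (Fin N)) (q : ℕ → K) :
    siegelIdeal K N A.card ⊓ Sp K (fun s : Finset (In N) => ptype s = fun c => if c ∈ A then 1 else 0)
      ≤ Kr K (Finset.univ : Finset (In N)) (w K N N q) A.card ⊓ Sp K (fun s : Finset (In N) => ptype s = fun c => if c ∈ A then 1 else 0) :=
  inf_le_inf (fun _ hθ => mem_Kr.mpr ⟨siegelIdeal_le_Hom_univ K _ hθ, mul_w_eq_zero_of_mem_siegelIdeal K hθ q⟩) le_rfl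

/-- **THE PURE PIECE OF THE KERNEL IS THE PURE PIECE OF THE SIEGEL IDEAL EXACTLY AT FULL HANKEL RANK: `Kr(univ, w_N q, |A|) ⊓ Sp(𝟙_A) = SI_{|A|} ⊓ Sp(𝟙_A) ↔ rank H_{|A|}(q) = |A| + 1`**
(gen 11's «kernel = Siegel ideal at the generic rank», piece by piece; every `A`, `q`, field). -/
theorem Kr_w_inf_Sp_pure_eq_siegelIdeal_inf_iff (A : Finset (Fin N)) (q : ℕ → K) :
    Kr K (Finset.univ : Finset (In N)) (w K N N q) A.card ⊓ Sp K (fun s : Finset (In N) => ptype s = fun c => if c ∈ A then 1 else 0)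
        = siegelIdeal K N A.card ⊓ Sp K (fun s : Finset (In N) => ptype s = fun c => if c ∈ A then 1 else 0)
      ↔ (hankel1 K N A.card q).rank = A.card + 1 := by
  have h := finrank_Kr_w_inf_Sp_pure_eq_siegelIdeal_add K A q
  constructor
  · intro he
    rw [he] at h
    omega
  · intro hr
    rw [hr] at h
    exact (Submodule.eq_of_le_of_finrank_eq (siegelIdeal_inf_Sp_pure_le_Kr K A q) (by omega)).symm

end Summit.Ventures.HSemireg.Wedge.HankelOuter
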